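import Summits.HodgeConjecture.HodgeConjecture.Theorems.WeilTypeLadderTargetTransferEightfolds
import Literature.AlgebraicGeometry.HodgeTheory.FermatHodgeConjectureProducts
import HarnessLib

/-!
# WeilTypeLadder · EIGHTFOLD cyclotomic loci with Shioda's product theorem as a NAMED FACT:
# R2₈ / R∞ over a pair of Fermat fourfolds `X⁴ₘ ⊗ X⁴ₘ` and over a quadruple of Fermat surfaces `(((X²ₘ ⊗ X²ₘ) ⊗ X²ₘ) ⊗ X²ₘ)`

b2b cell `hweil` (packet `run/shared/lean/b2b/hodge-weil/`, report `b2b-hweil-pv3-g39/ORDERING-LEMMA.md` ADDENDUM A). Companion of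
`Theorems/WeilTypeLadderTargetTransferEightfolds` (R∞- and R2₈-shaped bodies with the target's Hodge classes as a HYPOTHESIS `hXH`) and of
`Theorems/WeilTypeLadderTargetTransferFermatProducts` (the sixfold case C18 with named facts). Here `hXH` is DISCHARGED BY NAME from
the Literature facts `hodgeClasses_algebraic_fermatProduct₂` / `…Product₄` (Shioda, Proc. Japan Acad. 55A (1979) p. 112, Thm. 2:
the Hodge conjecture for arbitrary products of Fermat varieties of one degree `m`, `m` prime or `≤ 20`; `HodgeTheory/FermatHodgeConjectureProducts`)
for the two targets that the packet's PROPOSITION CYC uses in dimension `8`: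

* `E`-rank `4` (`m ∈ {8, 12}`, six branch points, `[ℚ(ζ_m):K] = 2`): partners on `X₁ ⊗ X₂`, `Xᵢ` Fermat FOURFOLDS of degree `m`;
* `E`-rank `2` (`m ∈ {15, 16, 20}`, four branch points, `[ℚ(ζ_m):K] = 4`): partners on `((X₁ ⊗ X₂) ⊗ X₃) ⊗ X₄`, `Xᵢ` Fermat SURFACES.

Declarations (each: from the facts / from the rung (datum unused) / ON-PATH from `HodgeConjecture`):
* `splitEightfolds_fermatFourfoldPairTransfer_…`, `splitEightfolds_fermatSurfaceQuadTransfer_…` — the body of R2₈ (`SplitEightfolds`,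
  every `d`, rung binders VERBATIM FIRST incl. the hyperbolicity binder), then the datum, then per class: rational `(4,4)` in the Weil
  plane with `a^* c ∈ ⨆ᵢ (bᵢ)^*(span of the rational (4,4)-classes of the target)` ⇒ algebraic;
* `weilClassesImaginaryQuadratic_fermatFourfoldPairTransfer_…`, `weilClassesImaginaryQuadratic_fermatSurfaceQuadTransfer_…` — the body of R∞
  (`WeilClassesImaginaryQuadratic`, every `n ≥ 2`, every `d`), then the datum (meaningful for `2n = 8`), then the per-class conclusion.

HONEST LABEL: which eightfolds carry the datum (ADDENDUM A: the `ζ_m`-primitive Pryms of the scanned `ℤ/m`-covers of `ℙ¹`, PROPOSITION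
CYC, pen-and-paper), which of them are split (THEOREM SCAN-CYC⁸, machine-exact) are NOT decided in the kernel; sub-families, not general
members; 0 unconditional rungs; conditional on [Shioda 1979 Thm. 2] + [Fulton 1998 Cor. 19.2 (b)] (refereed) and on the datum;
Markman-free. No `sorry`, no new definition, no new named fact.
-/

noncomputable section

-- every declaration of this problem lives in `Summit.HodgeConjecture.HodgeConjecture.…` (summit = sub-problem)
set_option linter.dupNamespace false

open CategoryTheory MonoidalCategory
open Literature.AlgebraicGeometry Literature.AlgebraicGeometry.Motives
open Literature.AlgebraicGeometry.HodgeTheory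
open Literature.AlgebraicTopology.SingularHomology

namespace Summit.HodgeConjecture.HodgeConjecture.WeilTypeLadder

/-! ### §0 Span form of the four-factor fact -/

section Span

/-- **Span form, four factors**: under `hodgeClasses_algebraic_fermatProduct₄`, on `((X₁ ⊗ X₂) ⊗ X₃) ⊗ X₄` (Fermat varieties of one
degree `m`, `m` prime or `1 < m ≤ 20`) the `ℂ`-span of the rational `(p,p)`-classes consists of algebraic classes.
[cite: Shioda1979PJA, §2 Thm. 2 (p. 112) with the list after Thm. 1] -/
theorem span_rational_hodge_le_algebraicClasses_fermatProduct₄ (h : hodgeClasses_algebraic_fermatProduct₄)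
    {m n₁ n₂ n₃ n₄ : ℕ} {X₁ X₂ X₃ X₄ : Motives.SchemeOver ℂ} (hm : m.Prime ∨ (1 < m ∧ m ≤ 20))
    (hF₁ : IsFermatVariety n₁ m X₁) (hX₁ : IsSmoothProjective n₁ X₁) (hF₂ : IsFermatVariety n₂ m X₂) (hX₂ : IsSmoothProjective n₂ X₂)
    (hF₃ : IsFermatVariety n₃ m X₃) (hX₃ : IsSmoothProjective n₃ X₃) (hF₄ : IsFermatVariety n₄ m X₄) (hX₄ : IsSmoothProjective n₄ X₄)
    (p : ℕ) :
    Submodule.span ℂ {x : complexBetti (((X₁ ⊗ X₂) ⊗ X₃) ⊗ X₄) (2 * p) |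
        IsRationalClass x ∧ IsOfHodgeType (n₁ + n₂ + n₃ + n₄) (((X₁ ⊗ X₂) ⊗ X₃) ⊗ X₄) (2 * p) p p x} ≤
      algebraicClasses (((X₁ ⊗ X₂) ⊗ X₃) ⊗ X₄) p :=
  Submodule.span_le.2 fun y hy ↦ h hm hF₁ hX₁ hF₂ hX₂ hF₃ hX₃ hF₄ hX₄ p y hy.1 hy.2

end Span

/-! ### §1 R2₈ over a pair of Fermat fourfolds and over a quadruple of Fermat surfaces, from the named facts -/

section Rtwo

/-- **R2₈ on the `X⁴ₘ ⊗ X⁴ₘ`-dominated locus, from the facts** (`m` prime or `1 < m ≤ 20`): the body of `SplitEightfolds` (rung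
binders first and verbatim), then the datum `(m, X₁ X₂ T, Fermat fourfolds, dim T = 8, a surjective, ι, b)`, then the per-class
conclusion. [cite: Shioda1979PJA, §2 Thm. 2 (p. 112) with the list after Thm. 1] [cite: Fulton1998, §19.2 Cor. 19.2 (b)] -/
theorem splitEightfolds_fermatFourfoldPairTransfer_of_facts
    (hF₂ : hodgeClasses_algebraic_fermatProduct₂) (hP : fulton1998_map_mem_algebraicClasses) :
    ∀ (d : ℕ), 0 < d → ∀ (A : Motives.AbelianVariety ℂ) (φ : A ⟶ A), A.dim = 2 * 4 →
      Motives.IsSmoothProjective (2 * 4) A.X → φ ≫ φ = -(d • 𝟙 A) →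
      ∀ (e : Motives.ProjectiveEmbedding A.X)
        (a : complexBetti (Motives.projectiveSpace e.n ℂ) 2), IsRationalClass a → a ≠ 0 →
        Motives.IsHyperbolicWeilType A φ 4
          ((d : ℂ) • complexBetti.map e.ι 2 a +
            complexBetti.map φ.hom.hom.hom 2 (complexBetti.map e.ι 2 a)) →
    ∀ (m : ℕ), m.Prime ∨ (1 < m ∧ m ≤ 20) → ∀ (X₁ X₂ T : Motives.SchemeOver ℂ),
      IsFermatVariety 4 m X₁ → IsSmoothProjective 4 X₁ → IsFermatVariety 4 m X₂ → IsSmoothProjective 4 X₂ →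
      IsSmoothProjective (2 * 4) T →
    ∀ (a' : T ⟶ A.X), AlgebraicGeometry.Surjective a'.left → ∀ (ι : Type) (b : ι → (T ⟶ X₁ ⊗ X₂)),
      ∀ c : complexBetti A.X (2 * 4),
        complexBetti.map a' (2 * 4) c ∈ (⨆ i, (Submodule.span ℂ
            {x : complexBetti (X₁ ⊗ X₂) (2 * 4) | IsRationalClass x ∧ IsOfHodgeType (4 + 4) (X₁ ⊗ X₂) (2 * 4) 4 4 x}).map
              (complexBetti.map (b i) (2 * 4)).hom) →
        IsRationalClass c → IsOfHodgeType (2 * 4) A.X (2 * 4) 4 4 c → c ∈ weilClassesOf A φ 4 d →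
          c ∈ algebraicClasses A.X 4 := by
  intro d _ A φ hA _ _ e a₀ _ _ _ m hm X₁ X₂ T hF₁' hX₁ hF₂' hX₂ hT a' ha ι b c hc _ _ _
  exact abelianVariety_mem_algebraicClasses_of_targetTransferFamily hP A (hX₁.tensor_holds hX₂)
    (span_rational_hodge_le_algebraicClasses_fermatProduct₂ hF₂ hm hF₁' hX₁ hF₂' hX₂ 4) (hA ▸ hT) a' b hc

/-- **The same body from the rung R2₈ itself** (`SplitEightfolds`; the datum is not used). -/
theorem splitEightfolds_fermatFourfoldPairTransfer_of_splitEightfolds (h : SplitEightfolds) :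
    ∀ (d : ℕ), 0 < d → ∀ (A : Motives.AbelianVariety ℂ) (φ : A ⟶ A), A.dim = 2 * 4 →
      Motives.IsSmoothProjective (2 * 4) A.X → φ ≫ φ = -(d • 𝟙 A) →
      ∀ (e : Motives.ProjectiveEmbedding A.X)
        (a : complexBetti (Motives.projectiveSpace e.n ℂ) 2), IsRationalClass a → a ≠ 0 →
        Motives.IsHyperbolicWeilType A φ 4
          ((d : ℂ) • complexBetti.map e.ι 2 a +
            complexBetti.map φ.hom.hom.hom 2 (complexBetti.map e.ι 2 a)) →
    ∀ (m : ℕ), m.Prime ∨ (1 < m ∧ m ≤ 20) → ∀ (X₁ X₂ T : Motives.SchemeOver ℂ),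
      IsFermatVariety 4 m X₁ → IsSmoothProjective 4 X₁ → IsFermatVariety 4 m X₂ → IsSmoothProjective 4 X₂ →
      IsSmoothProjective (2 * 4) T →
    ∀ (a' : T ⟶ A.X), AlgebraicGeometry.Surjective a'.left → ∀ (ι : Type) (b : ι → (T ⟶ X₁ ⊗ X₂)),
      ∀ c : complexBetti A.X (2 * 4),
        complexBetti.map a' (2 * 4) c ∈ (⨆ i, (Submodule.span ℂ
            {x : complexBetti (X₁ ⊗ X₂) (2 * 4) | IsRationalClass x ∧ IsOfHodgeType (4 + 4) (X₁ ⊗ X₂) (2 * 4) 4 4 x}).map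
              (complexBetti.map (b i) (2 * 4)).hom) →
        IsRationalClass c → IsOfHodgeType (2 * 4) A.X (2 * 4) 4 4 c → c ∈ weilClassesOf A φ 4 d →
          c ∈ algebraicClasses A.X 4 := by
  intro d hd A φ hA hS hφ e a₀ hr₀ hne hhyp _ _ _ _ _ _ _ _ _ _ _ _ _ _ c _ hr ht hw
  exact h d hd A φ hA hS hφ e a₀ hr₀ hne hhyp c hr ht hw

/-- **On-path lemma** (`HodgeConjecture → SplitEightfolds →` the `X⁴ₘ ⊗ X⁴ₘ`-dominated locus). -/
theorem splitEightfolds_fermatFourfoldPairTransfer_of_hodgeConjecture (h : _root_.HodgeConjecture) :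
    ∀ (d : ℕ), 0 < d → ∀ (A : Motives.AbelianVariety ℂ) (φ : A ⟶ A), A.dim = 2 * 4 →
      Motives.IsSmoothProjective (2 * 4) A.X → φ ≫ φ = -(d • 𝟙 A) →
      ∀ (e : Motives.ProjectiveEmbedding A.X)
        (a : complexBetti (Motives.projectiveSpace e.n ℂ) 2), IsRationalClass a → a ≠ 0 →
        Motives.IsHyperbolicWeilType A φ 4
          ((d : ℂ) • complexBetti.map e.ι 2 a +
            complexBetti.map φ.hom.hom.hom 2 (complexBetti.map e.ι 2 a)) →
    ∀ (m : ℕ), m.Prime ∨ (1 < m ∧ m ≤ 20) → ∀ (X₁ X₂ T : Motives.SchemeOver ℂ),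
      IsFermatVariety 4 m X₁ → IsSmoothProjective 4 X₁ → IsFermatVariety 4 m X₂ → IsSmoothProjective 4 X₂ →
      IsSmoothProjective (2 * 4) T →
    ∀ (a' : T ⟶ A.X), AlgebraicGeometry.Surjective a'.left → ∀ (ι : Type) (b : ι → (T ⟶ X₁ ⊗ X₂)),
      ∀ c : complexBetti A.X (2 * 4),
        complexBetti.map a' (2 * 4) c ∈ (⨆ i, (Submodule.span ℂ
            {x : complexBetti (X₁ ⊗ X₂) (2 * 4) | IsRationalClass x ∧ IsOfHodgeType (4 + 4) (X₁ ⊗ X₂) (2 * 4) 4 4 x}).map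
              (complexBetti.map (b i) (2 * 4)).hom) →
        IsRationalClass c → IsOfHodgeType (2 * 4) A.X (2 * 4) 4 4 c → c ∈ weilClassesOf A φ 4 d →
          c ∈ algebraicClasses A.X 4 :=
  splitEightfolds_fermatFourfoldPairTransfer_of_splitEightfolds (splitEightfolds_of_hodgeConjecture h)

/-- **R2₈ on the `(X²ₘ)^{⊗4}`-dominated locus, from the facts** (`m` prime or `1 < m ≤ 20`): the body of `SplitEightfolds`, then the
datum `(m, X₁ X₂ X₃ X₄ T, Fermat surfaces, dim T = 8, a surjective, ι, b : ι → (T ⟶ ((X₁ ⊗ X₂) ⊗ X₃) ⊗ X₄))`, then the per-class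
conclusion. [cite: Shioda1979PJA, §2 Thm. 2 (p. 112) with the list after Thm. 1] [cite: Fulton1998, §19.2 Cor. 19.2 (b)] -/
theorem splitEightfolds_fermatSurfaceQuadTransfer_of_facts
    (hF₄ : hodgeClasses_algebraic_fermatProduct₄) (hP : fulton1998_map_mem_algebraicClasses) :
    ∀ (d : ℕ), 0 < d → ∀ (A : Motives.AbelianVariety ℂ) (φ : A ⟶ A), A.dim = 2 * 4 →
      Motives.IsSmoothProjective (2 * 4) A.X → φ ≫ φ = -(d • 𝟙 A) →
      ∀ (e : Motives.ProjectiveEmbedding A.X)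
        (a : complexBetti (Motives.projectiveSpace e.n ℂ) 2), IsRationalClass a → a ≠ 0 →
        Motives.IsHyperbolicWeilType A φ 4
          ((d : ℂ) • complexBetti.map e.ι 2 a +
            complexBetti.map φ.hom.hom.hom 2 (complexBetti.map e.ι 2 a)) →
    ∀ (m : ℕ), m.Prime ∨ (1 < m ∧ m ≤ 20) → ∀ (X₁ X₂ X₃ X₄ T : Motives.SchemeOver ℂ),
      IsFermatVariety 2 m X₁ → IsSmoothProjective 2 X₁ → IsFermatVariety 2 m X₂ → IsSmoothProjective 2 X₂ →
      IsFermatVariety 2 m X₃ → IsSmoothProjective 2 X₃ → IsFermatVariety 2 m X₄ → IsSmoothProjective 2 X₄ →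
      IsSmoothProjective (2 * 4) T →
    ∀ (a' : T ⟶ A.X), AlgebraicGeometry.Surjective a'.left → ∀ (ι : Type) (b : ι → (T ⟶ ((X₁ ⊗ X₂) ⊗ X₃) ⊗ X₄)),
      ∀ c : complexBetti A.X (2 * 4),
        complexBetti.map a' (2 * 4) c ∈ (⨆ i, (Submodule.span ℂ
            {x : complexBetti (((X₁ ⊗ X₂) ⊗ X₃) ⊗ X₄) (2 * 4) |
              IsRationalClass x ∧ IsOfHodgeType (2 + 2 + 2 + 2) (((X₁ ⊗ X₂) ⊗ X₃) ⊗ X₄) (2 * 4) 4 4 x}).map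
                (complexBetti.map (b i) (2 * 4)).hom) →
        IsRationalClass c → IsOfHodgeType (2 * 4) A.X (2 * 4) 4 4 c → c ∈ weilClassesOf A φ 4 d →
          c ∈ algebraicClasses A.X 4 := by
  intro d _ A φ hA _ _ e a₀ _ _ _ m hm X₁ X₂ X₃ X₄ T hF₁' hX₁ hF₂' hX₂ hF₃' hX₃ hF₄' hX₄ hT a' ha ι b c hc _ _ _
  exact abelianVariety_mem_algebraicClasses_of_targetTransferFamily hP A
    (((hX₁.tensor_holds hX₂).tensor_holds hX₃).tensor_holds hX₄)
    (span_rational_hodge_le_algebraicClasses_fermatProduct₄ hF₄ hm hF₁' hX₁ hF₂' hX₂ hF₃' hX₃ hF₄' hX₄ 4) (hA ▸ hT) a' b hc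

/-- **The same body from the rung R2₈ itself** (`SplitEightfolds`; the datum is not used). -/
theorem splitEightfolds_fermatSurfaceQuadTransfer_of_splitEightfolds (h : SplitEightfolds) :
    ∀ (d : ℕ), 0 < d → ∀ (A : Motives.AbelianVariety ℂ) (φ : A ⟶ A), A.dim = 2 * 4 →
      Motives.IsSmoothProjective (2 * 4) A.X → φ ≫ φ = -(d • 𝟙 A) →
      ∀ (e : Motives.ProjectiveEmbedding A.X)
        (a : complexBetti (Motives.projectiveSpace e.n ℂ) 2), IsRationalClass a → a ≠ 0 →
        Motives.IsHyperbolicWeilType A φ 4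
          ((d : ℂ) • complexBetti.map e.ι 2 a +
            complexBetti.map φ.hom.hom.hom 2 (complexBetti.map e.ι 2 a)) →
    ∀ (m : ℕ), m.Prime ∨ (1 < m ∧ m ≤ 20) → ∀ (X₁ X₂ X₃ X₄ T : Motives.SchemeOver ℂ),
      IsFermatVariety 2 m X₁ → IsSmoothProjective 2 X₁ → IsFermatVariety 2 m X₂ → IsSmoothProjective 2 X₂ →
      IsFermatVariety 2 m X₃ → IsSmoothProjective 2 X₃ → IsFermatVariety 2 m X₄ → IsSmoothProjective 2 X₄ →
      IsSmoothProjective (2 * 4) T →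
    ∀ (a' : T ⟶ A.X), AlgebraicGeometry.Surjective a'.left → ∀ (ι : Type) (b : ι → (T ⟶ ((X₁ ⊗ X₂) ⊗ X₃) ⊗ X₄)),
      ∀ c : complexBetti A.X (2 * 4),
        complexBetti.map a' (2 * 4) c ∈ (⨆ i, (Submodule.span ℂ
            {x : complexBetti (((X₁ ⊗ X₂) ⊗ X₃) ⊗ X₄) (2 * 4) |
              IsRationalClass x ∧ IsOfHodgeType (2 + 2 + 2 + 2) (((X₁ ⊗ X₂) ⊗ X₃) ⊗ X₄) (2 * 4) 4 4 x}).map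
                (complexBetti.map (b i) (2 * 4)).hom) →
        IsRationalClass c → IsOfHodgeType (2 * 4) A.X (2 * 4) 4 4 c → c ∈ weilClassesOf A φ 4 d →
          c ∈ algebraicClasses A.X 4 := by
  intro d hd A φ hA hS hφ e a₀ hr₀ hne hhyp _ _ _ _ _ _ _ _ _ _ _ _ _ _ _ _ _ _ _ _ c _ hr ht hw
  exact h d hd A φ hA hS hφ e a₀ hr₀ hne hhyp c hr ht hw

/-- **On-path lemma** (`HodgeConjecture → SplitEightfolds →` the `(X²ₘ)^{⊗4}`-dominated locus). -/
theorem splitEightfolds_fermatSurfaceQuadTransfer_of_hodgeConjecture (h : _root_.HodgeConjecture) :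
    ∀ (d : ℕ), 0 < d → ∀ (A : Motives.AbelianVariety ℂ) (φ : A ⟶ A), A.dim = 2 * 4 →
      Motives.IsSmoothProjective (2 * 4) A.X → φ ≫ φ = -(d • 𝟙 A) →
      ∀ (e : Motives.ProjectiveEmbedding A.X)
        (a : complexBetti (Motives.projectiveSpace e.n ℂ) 2), IsRationalClass a → a ≠ 0 →
        Motives.IsHyperbolicWeilType A φ 4
          ((d : ℂ) • complexBetti.map e.ι 2 a +
            complexBetti.map φ.hom.hom.hom 2 (complexBetti.map e.ι 2 a)) →
    ∀ (m : ℕ), m.Prime ∨ (1 < m ∧ m ≤ 20) → ∀ (X₁ X₂ X₃ X₄ T : Motives.SchemeOver ℂ),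
      IsFermatVariety 2 m X₁ → IsSmoothProjective 2 X₁ → IsFermatVariety 2 m X₂ → IsSmoothProjective 2 X₂ →
      IsFermatVariety 2 m X₃ → IsSmoothProjective 2 X₃ → IsFermatVariety 2 m X₄ → IsSmoothProjective 2 X₄ →
      IsSmoothProjective (2 * 4) T →
    ∀ (a' : T ⟶ A.X), AlgebraicGeometry.Surjective a'.left → ∀ (ι : Type) (b : ι → (T ⟶ ((X₁ ⊗ X₂) ⊗ X₃) ⊗ X₄)),
      ∀ c : complexBetti A.X (2 * 4),
        complexBetti.map a' (2 * 4) c ∈ (⨆ i, (Submodule.span ℂ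
            {x : complexBetti (((X₁ ⊗ X₂) ⊗ X₃) ⊗ X₄) (2 * 4) |
              IsRationalClass x ∧ IsOfHodgeType (2 + 2 + 2 + 2) (((X₁ ⊗ X₂) ⊗ X₃) ⊗ X₄) (2 * 4) 4 4 x}).map
                (complexBetti.map (b i) (2 * 4)).hom) →
        IsRationalClass c → IsOfHodgeType (2 * 4) A.X (2 * 4) 4 4 c → c ∈ weilClassesOf A φ 4 d →
          c ∈ algebraicClasses A.X 4 :=
  splitEightfolds_fermatSurfaceQuadTransfer_of_splitEightfolds (splitEightfolds_of_hodgeConjecture h)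

end Rtwo

/-! ### §2 R∞ over the same two targets, from the named facts (the non-split eightfold loci) -/

section Rinfty

/-- **R∞ on the `X⁴ₘ ⊗ X⁴ₘ`-dominated locus, from the facts**: the body of `WeilClassesImaginaryQuadratic` (every `n ≥ 2`, every `d`,
rung binders first and verbatim), then the datum (Fermat fourfolds `X₁, X₂` of degree `m`, `dim T = 2n`, `a` surjective, `b`), then the
per-class conclusion (classes of degree `2n` on the `8`-dimensional target; the intended instance is `n = 4`).
[cite: Shioda1979PJA, §2 Thm. 2 (p. 112) with the list after Thm. 1] [cite: Fulton1998, §19.2 Cor. 19.2 (b)] -/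
theorem weilClassesImaginaryQuadratic_fermatFourfoldPairTransfer_of_facts
    (hF₂ : hodgeClasses_algebraic_fermatProduct₂) (hP : fulton1998_map_mem_algebraicClasses) :
    ∀ (n : ℕ), 2 ≤ n → ∀ (d : ℕ), 0 < d → ∀ (A : Motives.AbelianVariety ℂ) (φ : A ⟶ A), A.dim = 2 * n →
      Motives.IsSmoothProjective (2 * n) A.X → φ ≫ φ = -(d • 𝟙 A) →
    ∀ (m : ℕ), m.Prime ∨ (1 < m ∧ m ≤ 20) → ∀ (X₁ X₂ T : Motives.SchemeOver ℂ),
      IsFermatVariety 4 m X₁ → IsSmoothProjective 4 X₁ → IsFermatVariety 4 m X₂ → IsSmoothProjective 4 X₂ →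
      IsSmoothProjective (2 * n) T →
    ∀ (a : T ⟶ A.X), AlgebraicGeometry.Surjective a.left → ∀ (ι : Type) (b : ι → (T ⟶ X₁ ⊗ X₂)),
      ∀ c : complexBetti A.X (2 * n),
        complexBetti.map a (2 * n) c ∈ (⨆ i, (Submodule.span ℂ
            {x : complexBetti (X₁ ⊗ X₂) (2 * n) | IsRationalClass x ∧ IsOfHodgeType (4 + 4) (X₁ ⊗ X₂) (2 * n) n n x}).map
              (complexBetti.map (b i) (2 * n)).hom) →
        IsRationalClass c → IsOfHodgeType (2 * n) A.X (2 * n) n n c → c ∈ weilClassesOf A φ n d →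
          c ∈ algebraicClasses A.X n := by
  intro n _ d _ A φ hA _ _ m hm X₁ X₂ T hF₁' hX₁ hF₂' hX₂ hT a ha ι b c hc _ _ _
  exact abelianVariety_mem_algebraicClasses_of_targetTransferFamily hP A (hX₁.tensor_holds hX₂)
    (span_rational_hodge_le_algebraicClasses_fermatProduct₂ hF₂ hm hF₁' hX₁ hF₂' hX₂ n) (hA ▸ hT) a b hc

/-- **The same body from the rung R∞ itself** (`WeilClassesImaginaryQuadratic`; the datum is not used). -/
theorem weilClassesImaginaryQuadratic_fermatFourfoldPairTransfer_of_weilClassesImaginaryQuadratic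
    (h : WeilClassesImaginaryQuadratic) :
    ∀ (n : ℕ), 2 ≤ n → ∀ (d : ℕ), 0 < d → ∀ (A : Motives.AbelianVariety ℂ) (φ : A ⟶ A), A.dim = 2 * n →
      Motives.IsSmoothProjective (2 * n) A.X → φ ≫ φ = -(d • 𝟙 A) →
    ∀ (m : ℕ), m.Prime ∨ (1 < m ∧ m ≤ 20) → ∀ (X₁ X₂ T : Motives.SchemeOver ℂ),
      IsFermatVariety 4 m X₁ → IsSmoothProjective 4 X₁ → IsFermatVariety 4 m X₂ → IsSmoothProjective 4 X₂ →
      IsSmoothProjective (2 * n) T →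
    ∀ (a : T ⟶ A.X), AlgebraicGeometry.Surjective a.left → ∀ (ι : Type) (b : ι → (T ⟶ X₁ ⊗ X₂)),
      ∀ c : complexBetti A.X (2 * n),
        complexBetti.map a (2 * n) c ∈ (⨆ i, (Submodule.span ℂ
            {x : complexBetti (X₁ ⊗ X₂) (2 * n) | IsRationalClass x ∧ IsOfHodgeType (4 + 4) (X₁ ⊗ X₂) (2 * n) n n x}).map
              (complexBetti.map (b i) (2 * n)).hom) →
        IsRationalClass c → IsOfHodgeType (2 * n) A.X (2 * n) n n c → c ∈ weilClassesOf A φ n d →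
          c ∈ algebraicClasses A.X n := by
  intro n hn d hd A φ hA hS hφ _ _ _ _ _ _ _ _ _ _ _ _ _ _ c _ hr ht hw
  exact h n hn d hd A φ hA hS hφ c hr ht hw

/-- **On-path lemma** (`HodgeConjecture → WeilClassesImaginaryQuadratic →` the `X⁴ₘ ⊗ X⁴ₘ`-dominated locus). -/
theorem weilClassesImaginaryQuadratic_fermatFourfoldPairTransfer_of_hodgeConjecture (h : _root_.HodgeConjecture) :
    ∀ (n : ℕ), 2 ≤ n → ∀ (d : ℕ), 0 < d → ∀ (A : Motives.AbelianVariety ℂ) (φ : A ⟶ A), A.dim = 2 * n →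
      Motives.IsSmoothProjective (2 * n) A.X → φ ≫ φ = -(d • 𝟙 A) →
    ∀ (m : ℕ), m.Prime ∨ (1 < m ∧ m ≤ 20) → ∀ (X₁ X₂ T : Motives.SchemeOver ℂ),
      IsFermatVariety 4 m X₁ → IsSmoothProjective 4 X₁ → IsFermatVariety 4 m X₂ → IsSmoothProjective 4 X₂ →
      IsSmoothProjective (2 * n) T →
    ∀ (a : T ⟶ A.X), AlgebraicGeometry.Surjective a.left → ∀ (ι : Type) (b : ι → (T ⟶ X₁ ⊗ X₂)),
      ∀ c : complexBetti A.X (2 * n),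
        complexBetti.map a (2 * n) c ∈ (⨆ i, (Submodule.span ℂ
            {x : complexBetti (X₁ ⊗ X₂) (2 * n) | IsRationalClass x ∧ IsOfHodgeType (4 + 4) (X₁ ⊗ X₂) (2 * n) n n x}).map
              (complexBetti.map (b i) (2 * n)).hom) →
        IsRationalClass c → IsOfHodgeType (2 * n) A.X (2 * n) n n c → c ∈ weilClassesOf A φ n d →
          c ∈ algebraicClasses A.X n :=
  weilClassesImaginaryQuadratic_fermatFourfoldPairTransfer_of_weilClassesImaginaryQuadratic
    (weilClassesImaginaryQuadratic_of_hodgeConjecture h)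

/-- **R∞ on the `(X²ₘ)^{⊗4}`-dominated locus, from the facts**: the body of `WeilClassesImaginaryQuadratic`, then the datum (four
Fermat surfaces of degree `m`, `dim T = 2n`, `a` surjective, `b`), then the per-class conclusion (intended instance `n = 4`).
[cite: Shioda1979PJA, §2 Thm. 2 (p. 112) with the list after Thm. 1] [cite: Fulton1998, §19.2 Cor. 19.2 (b)] -/
theorem weilClassesImaginaryQuadratic_fermatSurfaceQuadTransfer_of_facts
    (hF₄ : hodgeClasses_algebraic_fermatProduct₄) (hP : fulton1998_map_mem_algebraicClasses) :
    ∀ (n : ℕ), 2 ≤ n → ∀ (d : ℕ), 0 < d → ∀ (A : Motives.AbelianVariety ℂ) (φ : A ⟶ A), A.dim = 2 * n →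
      Motives.IsSmoothProjective (2 * n) A.X → φ ≫ φ = -(d • 𝟙 A) →
    ∀ (m : ℕ), m.Prime ∨ (1 < m ∧ m ≤ 20) → ∀ (X₁ X₂ X₃ X₄ T : Motives.SchemeOver ℂ),
      IsFermatVariety 2 m X₁ → IsSmoothProjective 2 X₁ → IsFermatVariety 2 m X₂ → IsSmoothProjective 2 X₂ →
      IsFermatVariety 2 m X₃ → IsSmoothProjective 2 X₃ → IsFermatVariety 2 m X₄ → IsSmoothProjective 2 X₄ →
      IsSmoothProjective (2 * n) T →
    ∀ (a : T ⟶ A.X), AlgebraicGeometry.Surjective a.left → ∀ (ι : Type) (b : ι → (T ⟶ ((X₁ ⊗ X₂) ⊗ X₃) ⊗ X₄)),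
      ∀ c : complexBetti A.X (2 * n),
        complexBetti.map a (2 * n) c ∈ (⨆ i, (Submodule.span ℂ
            {x : complexBetti (((X₁ ⊗ X₂) ⊗ X₃) ⊗ X₄) (2 * n) |
              IsRationalClass x ∧ IsOfHodgeType (2 + 2 + 2 + 2) (((X₁ ⊗ X₂) ⊗ X₃) ⊗ X₄) (2 * n) n n x}).map
                (complexBetti.map (b i) (2 * n)).hom) →
        IsRationalClass c → IsOfHodgeType (2 * n) A.X (2 * n) n n c → c ∈ weilClassesOf A φ n d →
          c ∈ algebraicClasses A.X n := by
  intro n _ d _ A φ hA _ _ m hm X₁ X₂ X₃ X₄ T hF₁' hX₁ hF₂' hX₂ hF₃' hX₃ hF₄' hX₄ hT a ha ι b c hc _ _ _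
  exact abelianVariety_mem_algebraicClasses_of_targetTransferFamily hP A
    (((hX₁.tensor_holds hX₂).tensor_holds hX₃).tensor_holds hX₄)
    (span_rational_hodge_le_algebraicClasses_fermatProduct₄ hF₄ hm hF₁' hX₁ hF₂' hX₂ hF₃' hX₃ hF₄' hX₄ n) (hA ▸ hT) a b hc

/-- **The same body from the rung R∞ itself** (`WeilClassesImaginaryQuadratic`; the datum is not used). -/
theorem weilClassesImaginaryQuadratic_fermatSurfaceQuadTransfer_of_weilClassesImaginaryQuadratic
    (h : WeilClassesImaginaryQuadratic) :
    ∀ (n : ℕ), 2 ≤ n → ∀ (d : ℕ), 0 < d → ∀ (A : Motives.AbelianVariety ℂ) (φ : A ⟶ A), A.dim = 2 * n →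
      Motives.IsSmoothProjective (2 * n) A.X → φ ≫ φ = -(d • 𝟙 A) →
    ∀ (m : ℕ), m.Prime ∨ (1 < m ∧ m ≤ 20) → ∀ (X₁ X₂ X₃ X₄ T : Motives.SchemeOver ℂ),
      IsFermatVariety 2 m X₁ → IsSmoothProjective 2 X₁ → IsFermatVariety 2 m X₂ → IsSmoothProjective 2 X₂ →
      IsFermatVariety 2 m X₃ → IsSmoothProjective 2 X₃ → IsFermatVariety 2 m X₄ → IsSmoothProjective 2 X₄ →
      IsSmoothProjective (2 * n) T →
    ∀ (a : T ⟶ A.X), AlgebraicGeometry.Surjective a.left → ∀ (ι : Type) (b : ι → (T ⟶ ((X₁ ⊗ X₂) ⊗ X₃) ⊗ X₄)),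
      ∀ c : complexBetti A.X (2 * n),
        complexBetti.map a (2 * n) c ∈ (⨆ i, (Submodule.span ℂ
            {x : complexBetti (((X₁ ⊗ X₂) ⊗ X₃) ⊗ X₄) (2 * n) |
              IsRationalClass x ∧ IsOfHodgeType (2 + 2 + 2 + 2) (((X₁ ⊗ X₂) ⊗ X₃) ⊗ X₄) (2 * n) n n x}).map
                (complexBetti.map (b i) (2 * n)).hom) →
        IsRationalClass c → IsOfHodgeType (2 * n) A.X (2 * n) n n c → c ∈ weilClassesOf A φ n d →
          c ∈ algebraicClasses A.X n := by
  intro n hn d hd A φ hA hS hφ _ _ _ _ _ _ _ _ _ _ _ _ _ _ _ _ _ _ _ _ c _ hr ht hw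
  exact h n hn d hd A φ hA hS hφ c hr ht hw

/-- **On-path lemma** (`HodgeConjecture → WeilClassesImaginaryQuadratic →` the `(X²ₘ)^{⊗4}`-dominated locus). -/
theorem weilClassesImaginaryQuadratic_fermatSurfaceQuadTransfer_of_hodgeConjecture (h : _root_.HodgeConjecture) :
    ∀ (n : ℕ), 2 ≤ n → ∀ (d : ℕ), 0 < d → ∀ (A : Motives.AbelianVariety ℂ) (φ : A ⟶ A), A.dim = 2 * n →
      Motives.IsSmoothProjective (2 * n) A.X → φ ≫ φ = -(d • 𝟙 A) →
    ∀ (m : ℕ), m.Prime ∨ (1 < m ∧ m ≤ 20) → ∀ (X₁ X₂ X₃ X₄ T : Motives.SchemeOver ℂ),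
      IsFermatVariety 2 m X₁ → IsSmoothProjective 2 X₁ → IsFermatVariety 2 m X₂ → IsSmoothProjective 2 X₂ →
      IsFermatVariety 2 m X₃ → IsSmoothProjective 2 X₃ → IsFermatVariety 2 m X₄ → IsSmoothProjective 2 X₄ →
      IsSmoothProjective (2 * n) T →
    ∀ (a : T ⟶ A.X), AlgebraicGeometry.Surjective a.left → ∀ (ι : Type) (b : ι → (T ⟶ ((X₁ ⊗ X₂) ⊗ X₃) ⊗ X₄)),
      ∀ c : complexBetti A.X (2 * n),
        complexBetti.map a (2 * n) c ∈ (⨆ i, (Submodule.span ℂ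
            {x : complexBetti (((X₁ ⊗ X₂) ⊗ X₃) ⊗ X₄) (2 * n) |
              IsRationalClass x ∧ IsOfHodgeType (2 + 2 + 2 + 2) (((X₁ ⊗ X₂) ⊗ X₃) ⊗ X₄) (2 * n) n n x}).map
                (complexBetti.map (b i) (2 * n)).hom) →
        IsRationalClass c → IsOfHodgeType (2 * n) A.X (2 * n) n n c → c ∈ weilClassesOf A φ n d →
          c ∈ algebraicClasses A.X n :=
  weilClassesImaginaryQuadratic_fermatSurfaceQuadTransfer_of_weilClassesImaginaryQuadratic
    (weilClassesImaginaryQuadratic_of_hodgeConjecture h)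

end Rinfty

end Summit.HodgeConjecture.HodgeConjecture.WeilTypeLadder

end
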